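import Summits.CriticalPhenomena.PercolationContinuityZ3.Theorems.PercNearOneGluingNoHeavyQuantCatHullSmallGates
import HarnessLib

/-!
# QUANT lane R8, T-DEC: THE NESTED-GATE PAIR LEMMA — the ASYMMETRIC regime `m_Q ≤ T ≤ m_P` of the pair lemma (P): the join
# `gate_s P ∗ gate_t Q` is the three-column member `α·gate_{T/m_P} P + ω·(Q ∗ gate_γ P) + γ′·gate_{T/(m_P+m_Q)}(P ∗ Q)`,
# `γ = (T − m_Q)/m_P` (closed form; needs floor slack `y/γ` for `P`); unequal glued siblings in both regimes

builds on p205010 (kernel theorem, internal audit signed; external expert review pending)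

Support file (`--supports stmt-CriticalPhenomena-4575`), QUANT lane census seat prim-quant-census-2 (gen 77), rung R8 of
`run/shared/lean/prim/quant/LADDER.md`.  Theorems only (no definition, no conjecture); standard axioms, no sorries.  Sequel of
`…QuantCatHullSmallGates` (✓ p490773, the SMALL regime `T ≤ min(m_P, m_Q)`).

WHAT.  For the independent join of two gated columns, `gate_s P ∗ gate_t Q = st·(P∗Q) + s(1−t)·P + (1−s)t·Q + (1−s)(1−t)·δ₀`
(`lconv_gate_gate_expand`), target mean `T = s·m_P + t·m_Q`.  When `T ≤ m_P` but `T ≥ m_Q` (one factor's mean dominates the target, the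
other's does not — e.g. a big sibling beside a small one) the `Q`-mass cannot be re-gated UP to mean `T`; instead it is carried by the NESTED
caterpillar `Q ∗ gate_γ(P)` (`= γ·P∗Q + (1−γ)·Q`, `lconv_gate_left`) whose mean `m_Q + γ·m_P` is `T` for `γ = (T − m_Q)/m_P ∈ [0, 1]`:
  `gate_s P ∗ gate_t Q = α·gate_{T/m_P} P + ω·(gate_γ P ∗ Q) + γ′·gate_{T/(m_P+m_Q)} (P ∗ Q)`,
  `α = s(1−t)m_P/T`, `ω = (1−s)t·m_P/(m_P + m_Q − T)`, `γ′ = t(1−t)m_Q(m_P+m_Q)/(T(m_P + m_Q − T))`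
(`lconv_gate_gate_eq_nested`; the `δ₀`-masses balance exactly, `α + ω + γ′ = 1`).  PRICE: in the nested column `P` sits under the gate `γ < s`, so `P`
must be a caterpillar at the HIGHER floor `y/γ` (floor slack) — at a floor-tight law this is exactly the obstruction of FREEHULL-G75 §4c (`γ = 2q−1`
for the symmetric glued pair, where moreover `m_P = m_Q` leaves only `q = 1/2`); the lemma serves ASYMMETRIC pairs.
* **`InGatedCatHull.lconv_gate_gate_of_nested`** (hull-relative): `P ∈ FH(y₁, m_P)`, `gate_γ P ∗ Q ∈ FH(y₂, T)`, `P ∗ Q ∈ FH(y₃, m_P+m_Q)`,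
  `m_Q ≤ T ≤ m_P`, `t < 1` ⟹ `gate_s P ∗ gate_t Q ∈ FH(y, T)` at every floor `y ≤ y₂` with `y·m_P ≤ y₁·T`, `y(m_P+m_Q) ≤ y₃·T`;
* **`catPairBlob_inGatedCatHull_of_nested`** — caterpillar `P` (`CatBuilt x₁ N₁ P`) and blob forest `Q = blobLaw l`: member at floor `y` whenever
  `y·m_P ≤ (T − m_Q)·x₁` (the slack), `y(m_P + m_Q) ≤ x₁·T`, blob gates `g` with `y(m_P+m_Q) ≤ g·T`, and `m_Q ≤ T ≤ m_P` — an instance family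
  of (P) `CatPairLight` (columns `gate P s`, `gate (blobLaw l) t` at floor `y`);
* **`lpSib_pair_inGatedCatHull_of_small`** — UNEQUAL glued siblings `R¹[q](R^c[σ]) ∗ R¹[q′](R^{c′}[σ′])` in the SMALL regime
  (`q(1+cσ) + q′(1+c′σ′) ≤ min(1+cσ, 1+c′σ′)`, `q ≤ q′`) at every floor `y ≤ qσ, qσ′` (the natural floor when `σ ≤ σ′`), by p490773's
  `catPairBlob_inGatedCatHull_of_small`; **`lpSib_pair_inGatedCatHull_of_nested`** — the same pair in the asymmetric regime (explicit slack
  inequalities on the floor).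
HONEST STATUS.  Regions of (P) only; the symmetric corner `T > max(m_P, m_Q)` at a tight floor (the census's hard case) is untouched;
`TreeBuiltCatHullLight`, `CatPairLight`, `SiblingStep`, `FarTreeRow` remain OPEN; RATE class log\* / honest sentence of
`run/shared/lean/prim/quant/README.md` unchanged.  [this work]; hull API: prim-quant-stmt g41, prim-quant-lead g47; `lpSib`: prim-quant-census-2 g76.
Nothing here is cited as a published result.  The gluing rows served [cite: KozmaNitzan2024, Conjecture 3 (p. 15)]; product measure
[cite: Grimmett1999, §1.3 p. 10].
-/

noncomputable section

open scoped BigOperators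

namespace Summit.CriticalPhenomena.PercolationContinuityZ3.Theorems
namespace Quant
namespace LawDec

open Finset

/-! ### The nested re-gating identity (pure algebra) -/

/-- **THE NESTED IDENTITY.**  With `T = s·m₁ + t·m₂`, `γ = (T − m₂)/m₁`, `D = m₁ + m₂ − T` (all of `m₁, m₁ + m₂, T, D` nonzero):
`gate_s P ∗ gate_t Q = (s(1−t)m₁/T)·gate_{T/m₁} P + ((1−s)t·m₁/D)·(gate_γ P ∗ Q) + (t(1−t)m₂(m₁+m₂)/(T·D))·gate_{T/(m₁+m₂)}(P ∗ Q)`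
pointwise. [this work] -/
theorem lconv_gate_gate_eq_nested (N₁ N₂ : ℕ) (P Q : ℕ → ℝ) (s t m₁ m₂ : ℝ) (hPM : ∀ h, N₁ < h → P h = 0)
    (hQM : ∀ h, N₂ < h → Q h = 0) (hm₁ : m₁ ≠ 0) (hm : m₁ + m₂ ≠ 0) (hT : s * m₁ + t * m₂ ≠ 0)
    (hD : m₁ + m₂ - (s * m₁ + t * m₂) ≠ 0) (h : ℕ) :
    lconv N₁ N₂ (gate P s) (gate Q t) h =
      (s * (1 - t) * m₁ / (s * m₁ + t * m₂)) * gate P ((s * m₁ + t * m₂) / m₁) h +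
        ((1 - s) * t * m₁ / (m₁ + m₂ - (s * m₁ + t * m₂))) *
          lconv N₁ N₂ (gate P ((s * m₁ + t * m₂ - m₂) / m₁)) Q h +
        (t * (1 - t) * m₂ * (m₁ + m₂) / ((s * m₁ + t * m₂) * (m₁ + m₂ - (s * m₁ + t * m₂)))) *
          gate (lconv N₁ N₂ P Q) ((s * m₁ + t * m₂) / (m₁ + m₂)) h := by
  rw [lconv_gate_gate_expand N₁ N₂ P Q s t hPM hQM h, lconv_gate_left N₁ N₂ P Q _ hQM h, gate_apply, gate_apply]
  field_simp
  ring

/-! ### The nested-gate pair lemma, hull-relative form -/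

/-- **THE NESTED-GATE PAIR LEMMA (hull-relative).**  Members `P ∈ FH(y₁, m₁, N₁)`, `gate_γ P ∗ Q ∈ FH(y₂, T, N₁ + N₂)` (the nested column,
`γ = (T − m₂)/m₁`), `P ∗ Q ∈ FH(y₃, m₁ + m₂, N₁ + N₂)`, `Q` a law on `{0..N₂}` (vanishing above `N₂`), outer gates `0 ≤ s ≤ 1`, `0 ≤ t < 1`
in the ASYMMETRIC regime `m₂ ≤ T := s·m₁ + t·m₂ ≤ m₁` (`0 < m₂`): the join `gate_s P ∗ gate_t Q` lies in `FH(y, T, N₁ + N₂)` at every floor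
`0 < y ≤ y₂` with `y·m₁ ≤ y₁·T` and `y·(m₁ + m₂) ≤ y₃·T`. [this work] -/
theorem InGatedCatHull.lconv_gate_gate_of_nested {y y₁ y₂ y₃ m₁ m₂ s t : ℝ} {N₁ N₂ : ℕ} {P Q : ℕ → ℝ}
    (hP : InGatedCatHull y₁ m₁ N₁ P)
    (hN : InGatedCatHull y₂ (s * m₁ + t * m₂) (N₁ + N₂) (lconv N₁ N₂ (gate P ((s * m₁ + t * m₂ - m₂) / m₁)) Q))
    (hPQ : InGatedCatHull y₃ (m₁ + m₂) (N₁ + N₂) (lconv N₁ N₂ P Q)) (hQM : ∀ h, N₂ < h → Q h = 0)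
    (hy0 : 0 < y) (hy₁ : 0 ≤ y₁) (hy₃ : 0 ≤ y₃) (hm₂ : 0 < m₂)
    (hs0 : 0 ≤ s) (hs1 : s ≤ 1) (ht0 : 0 ≤ t) (ht1 : t < 1)
    (hT₁ : s * m₁ + t * m₂ ≤ m₁) (hT₂ : m₂ ≤ s * m₁ + t * m₂)
    (hf₁ : y * m₁ ≤ y₁ * (s * m₁ + t * m₂)) (hf₂ : y ≤ y₂) (hf₃ : y * (m₁ + m₂) ≤ y₃ * (s * m₁ + t * m₂)) :
    InGatedCatHull y (s * m₁ + t * m₂) (N₁ + N₂) (lconv N₁ N₂ (gate P s) (gate Q t)) := by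
  set T := s * m₁ + t * m₂ with hTdef
  have hT0 : 0 < T := lt_of_lt_of_le hm₂ hT₂
  have hm₁ : 0 < m₁ := lt_of_lt_of_le hT0 hT₁
  have hm : 0 < m₁ + m₂ := by linarith
  have hD : 0 < m₁ + m₂ - T := by nlinarith
  have hT₃ : T ≤ m₁ + m₂ := by linarith
  have hA : InGatedCatHull y T (N₁ + N₂) (gate P (T / m₁)) := by
    have g := inGatedCatHull_gate hP hy₁ (T / m₁) (div_pos hT0 hm₁) ((div_le_one hm₁).2 hT₁)
    rw [div_mul_cancel₀ T hm₁.ne'] at g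
    have hfl : y ≤ T / m₁ * y₁ := by
      rw [div_mul_eq_mul_div, le_div_iff₀ hm₁]; nlinarith [hf₁]
    exact (g.mono hy0 hfl).mono_top (Nat.le_add_right N₁ N₂)
  have hB : InGatedCatHull y T (N₁ + N₂) (lconv N₁ N₂ (gate P ((T - m₂) / m₁)) Q) := hN.mono hy0 hf₂
  have hC : InGatedCatHull y T (N₁ + N₂) (gate (lconv N₁ N₂ P Q) (T / (m₁ + m₂))) := by
    have g := inGatedCatHull_gate hPQ hy₃ (T / (m₁ + m₂)) (div_pos hT0 hm) ((div_le_one hm).2 hT₃)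
    rw [div_mul_cancel₀ T hm.ne'] at g
    have hfl : y ≤ T / (m₁ + m₂) * y₃ := by
      rw [div_mul_eq_mul_div, le_div_iff₀ hm]; nlinarith [hf₃]
    exact g.mono hy0 hfl
  have hPM : ∀ h, N₁ < h → P h = 0 := (hP.lawFacts hy₁).2.1
  refine InGatedCatHull.mix3 (s * (1 - t) * m₁ / T) ((1 - s) * t * m₁ / (m₁ + m₂ - T))
    (t * (1 - t) * m₂ * (m₁ + m₂) / (T * (m₁ + m₂ - T)))
    (div_nonneg (mul_nonneg (mul_nonneg hs0 (by linarith)) hm₁.le) hT0.le)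
    (div_nonneg (mul_nonneg (mul_nonneg (by linarith) ht0) hm₁.le) hD.le)
    (div_nonneg (mul_nonneg (mul_nonneg (mul_nonneg ht0 (by linarith)) hm₂.le) hm.le) (mul_pos hT0 hD).le) ?_ hA hB hC
    fun h => ?_
  · field_simp
    ring
  · exact lconv_gate_gate_eq_nested N₁ N₂ P Q s t m₁ m₂ hPM hQM hm₁.ne' hm.ne' hT0.ne' hD.ne' h

/-! ### Caterpillar columns: `P` a caterpillar with floor slack, `Q` a blob forest -/

/-- **(P) IN THE ASYMMETRIC REGIME, `Q` A BLOB FOREST.**  A caterpillar `P` (`CatBuilt x₁ N₁ P`, mean `m_P`) and a blob forest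
`Q = blobLaw l` (mean `m_Q = blobMean l > 0`), outer gates `0 < s ≤ 1`, `0 < t < 1` with `m_Q ≤ T := s·m_P + t·m_Q ≤ m_P`, at a floor
`0 < y` (`y < s`, `y < t`) affording (a) the SLACK `y·m_P ≤ (T − m_Q)·x₁` (so `P` sits under the nested gate `γ = (T−m_Q)/m_P`), (b)
`y·(m_P + m_Q) ≤ x₁·T` and blob gates `g ≤ 1` with `y·(m_P + m_Q) ≤ g·T` (so `P ∗ Q` sits under the gate `T/(m_P+m_Q)`): the join
`gate_s P ∗ gate_t (blobLaw l)` lies in `FH(y, T, N₁ + blobTop l)`. [this work] -/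
theorem catPairBlob_inGatedCatHull_of_nested {y s t x₁ : ℝ} {N₁ : ℕ} {P : ℕ → ℝ} (l : List (ℕ × ℝ))
    (hy0 : 0 < y) (hys : y < s) (hs1 : s ≤ 1) (hyt : y < t) (ht1 : t < 1) (hx₁ : x₁ < 1) (hP : CatBuilt x₁ N₁ P)
    (hmQ : 0 < blobMean l)
    (hT₁ : s * (∑ h ∈ Finset.range (N₁ + 1), (h : ℝ) * P h) + t * blobMean l ≤ ∑ h ∈ Finset.range (N₁ + 1), (h : ℝ) * P h)
    (hT₂ : blobMean l ≤ s * (∑ h ∈ Finset.range (N₁ + 1), (h : ℝ) * P h) + t * blobMean l)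
    (hslack : y * (∑ h ∈ Finset.range (N₁ + 1), (h : ℝ) * P h)
      ≤ (s * (∑ h ∈ Finset.range (N₁ + 1), (h : ℝ) * P h) + t * blobMean l - blobMean l) * x₁)
    (hf : y * ((∑ h ∈ Finset.range (N₁ + 1), (h : ℝ) * P h) + blobMean l)
      ≤ x₁ * (s * (∑ h ∈ Finset.range (N₁ + 1), (h : ℝ) * P h) + t * blobMean l))
    (hl : ∀ p ∈ l, y * ((∑ h ∈ Finset.range (N₁ + 1), (h : ℝ) * P h) + blobMean l)
      ≤ p.2 * (s * (∑ h ∈ Finset.range (N₁ + 1), (h : ℝ) * P h) + t * blobMean l) ∧ p.2 ≤ 1) :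
    InGatedCatHull y (s * (∑ h ∈ Finset.range (N₁ + 1), (h : ℝ) * P h) + t * blobMean l) (N₁ + blobTop l)
      (lconv N₁ (blobTop l) (gate P s) (gate (blobLaw l) t)) := by
  set mP := ∑ h ∈ Finset.range (N₁ + 1), (h : ℝ) * P h with hmPdef
  set mQ := blobMean l with hmQdef
  set T := s * mP + t * mQ with hTdef
  have hs0 : 0 < s := hy0.trans hys
  have ht0 : 0 < t := hy0.trans hyt
  have hT0 : 0 < T := lt_of_lt_of_le hmQ hT₂
  have hmP : 0 < mP := lt_of_lt_of_le hT0 hT₁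
  have hx0 : 0 < x₁ := hP.floor.1
  have hγ0 : 0 < T - mQ := by
    -- `T − m_Q = s·m_P − (1−t)·m_Q ≥ y·m_P/x₁ > 0`
    have : 0 < y * mP := mul_pos hy0 hmP
    nlinarith
  have hγ1 : (T - mQ) / mP ≤ 1 := by rw [div_le_one hmP]; nlinarith [hmQ.le]
  obtain ⟨p0, pM, p1, _⟩ := hP.lawFacts
  -- the blob gates lie in `[y, 1]` and in `[y·(m_P+m_Q)/T, 1]`
  have hwle : y ≤ y * (mP + mQ) / T := by
    rw [le_div_iff₀ hT0]; nlinarith [mul_nonneg hy0.le hmQ.le, mul_nonneg hy0.le hmP.le]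
  have hly : ∀ p ∈ l, y ≤ p.2 ∧ p.2 ≤ 1 := fun p hp => by
    refine ⟨?_, (hl p hp).2⟩
    have h1 := (hl p hp).1
    by_contra hlt
    rw [not_le] at hlt
    have : p.2 * T < y * T := mul_lt_mul_of_pos_right hlt hT0
    nlinarith [mul_nonneg hy0.le hmQ.le, mul_nonneg hy0.le hmP.le]
  -- member 1: `P` at its own floor
  have hP' : InGatedCatHull x₁ mP N₁ P := inGatedCatHull_of_catBuilt hP
  -- member 2: the nested column `gate_γ P ∗ blobLaw l`, a caterpillar at floor `y`
  have hγfl : y ≤ (T - mQ) / mP * x₁ := by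
    rw [div_mul_eq_mul_div, le_div_iff₀ hmP]; linarith [hslack]
  have hNc : CatBuilt y (N₁ + blobTop l) (lconv N₁ (blobTop l) (gate P ((T - mQ) / mP)) (blobLaw l)) :=
    catBuilt_lconv_blobLaw (((hP.gate _ (div_pos hγ0 hmP) hγ1).mono hy0 hγfl)) l hly
  have hN : InGatedCatHull y T (N₁ + blobTop l) (lconv N₁ (blobTop l) (gate P ((T - mQ) / mP)) (blobLaw l)) := by
    have g := inGatedCatHull_of_catBuilt hNc
    obtain ⟨_, gM, g1⟩ := gate_laws N₁ P ((T - mQ) / mP) (div_pos hγ0 hmP).le hγ1 p0 pM p1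
    rw [sum_mul_lconv N₁ (blobTop l) _ _ g1 (sum_blobLaw l), sum_mul_gate, sum_mul_blobLaw] at g
    have e : (T - mQ) / mP * mP + mQ = T := by field_simp; ring
    rwa [e] at g
  -- member 3: `P ∗ blobLaw l`, a caterpillar at floor `y(m_P+m_Q)/T`
  have hw1 : y * (mP + mQ) / T ≤ x₁ := by rw [div_le_iff₀ hT0]; linarith [hf]
  have hPQc : CatBuilt (y * (mP + mQ) / T) (N₁ + blobTop l) (lconv N₁ (blobTop l) P (blobLaw l)) :=
    catBuilt_lconv_blobLaw (hP.mono (lt_of_lt_of_le hy0 hwle) hw1) l fun p hp =>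
      ⟨by rw [div_le_iff₀ hT0]; exact (hl p hp).1, (hl p hp).2⟩
  have hPQ : InGatedCatHull (y * (mP + mQ) / T) (mP + mQ) (N₁ + blobTop l) (lconv N₁ (blobTop l) P (blobLaw l)) := by
    have g := inGatedCatHull_of_catBuilt hPQc
    rwa [sum_mul_lconv N₁ (blobTop l) _ _ p1 (sum_blobLaw l), sum_mul_blobLaw] at g
  have hmm : (0 : ℝ) ≤ mP + mQ := by linarith
  refine InGatedCatHull.lconv_gate_gate_of_nested hP' hN hPQ (fun h hh => blobLaw_eq_zero l h hh) hy0 hx0.le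
    (div_nonneg (mul_nonneg hy0.le hmm) hT0.le) hmQ hs0.le hs1 ht0.le ht1 hT₁ hT₂ ?_ le_rfl ?_
  · nlinarith [hf, mul_nonneg hx0.le (mul_nonneg ht0.le hmQ.le), mul_nonneg hy0.le hmQ.le]
  · rw [div_mul_cancel₀ _ hT0.ne']

/-! ### Unequal glued siblings `R¹[q](R^c[σ]) ∗ R¹[q′](R^{c′}[σ′])` -/

/-- **UNEQUAL GLUED SIBLINGS, SMALL REGIME.**  For root gates `0 < q ≤ q′ ≤ 1`, blob gates `0 < σ < 1`, `0 < σ′ ≤ 1` and means `m = 1 + cσ`,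
`m′ = 1 + c′σ′` with SMALL gates `q·m + q′·m′ ≤ min(m, m′)`: the join `lpSib c q σ ∗ lpSib c′ q′ σ′` lies in the gated caterpillar hull at
every floor `0 < y ≤ qσ, qσ′` (the natural floor `min(qσ, q′σ′)` when `σ ≤ σ′`), mean `q·m + q′·m′`, top `(c+1) + (c′+1)`
(`catPairBlob_inGatedCatHull_of_small` of ✓ p490773). [this work] -/
theorem lpSib_pair_inGatedCatHull_of_small (c c' : ℕ) (q σ q' σ' y : ℝ) (hy0 : 0 < y) (hyσ : y ≤ q * σ) (hyσ' : y ≤ q * σ')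
    (hq0 : 0 < q) (hqq : q ≤ q') (hq1 : q' ≤ 1) (hσ1 : σ < 1) (hσ'1 : σ' ≤ 1)
    (hT₁ : q * (1 + c * σ) + q' * (1 + c' * σ') ≤ 1 + c * σ) (hT₂ : q * (1 + c * σ) + q' * (1 + c' * σ') ≤ 1 + c' * σ') :
    InGatedCatHull y (q * (1 + c * σ) + q' * (1 + c' * σ')) (c + 1 + (c' + 1))
      (lconv (c + 1) (c' + 1) (lpSib c q σ) (lpSib c' q' σ')) := by
  have hσ0 : 0 < σ := by nlinarith
  have hys : y < q := by nlinarith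
  have hyq0 : 0 < y / q := div_pos hy0 hq0
  have hyq1 : y / q < 1 := (div_lt_one hq0).2 hys
  have hyqσ : y / q ≤ σ := by rw [div_le_iff₀ hq0]; linarith
  have hyqσ' : y / q ≤ σ' := by rw [div_le_iff₀ hq0]; linarith
  have hP : CatBuilt (y / q) (c + 1) (slice (pointLaw 1) c σ) := cat_lpRho c σ (y / q) hyq0 hyq1 hyqσ hσ1.le
  have hm : 0 < 1 + (c : ℝ) * σ := by positivity
  have hm' : 0 < 1 + (c' : ℝ) * σ' := by
    have : (0 : ℝ) ≤ c' * σ' := mul_nonneg (Nat.cast_nonneg _) (by linarith)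
    linarith
  have key := catPairBlob_inGatedCatHull_of_small [(c', σ'), (1, 1)] hy0 hys hqq hq1 hP
    (fun p hp => by
      simp only [List.mem_cons, List.not_mem_nil, or_false] at hp
      rcases hp with rfl | rfl
      · exact ⟨hyqσ', hσ'1⟩
      · exact ⟨hyq1.le, le_rfl⟩)
    (by rw [lpRho_mean]; exact hm) (by rw [lpRho_blobMean]; exact hm')
    (by rw [lpRho_mean, lpRho_blobMean]; exact hT₁) (by rw [lpRho_mean, lpRho_blobMean]; exact hT₂)
  rw [lpRho_mean, lpRho_blobMean, lpRho_blobTop, ← lpRho_eq_blobLaw] at key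
  exact key

/-- **UNEQUAL GLUED SIBLINGS, ASYMMETRIC REGIME** (big sibling `P = R¹[q](R^c[σ])` with slack beside a small sibling `R¹[q′](R^{c′}[σ′])` that
sets the floor).  With `m = 1 + cσ`, `m′ = 1 + c′σ′`, `T = q·m + q′·m′`: if `m′ ≤ T ≤ m`, `q′ < 1`, and the floor `0 < y` (`y < q`, `y < q′`)
satisfies the slack `y·m ≤ (T − m′)·σ`, `y·(m + m′) ≤ σ·T`, `y·(m + m′) ≤ σ′·T`, then the join lies in `FH(y, T, (c+1) + (c′+1))`
(`catPairBlob_inGatedCatHull_of_nested`). [this work] -/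
theorem lpSib_pair_inGatedCatHull_of_nested (c c' : ℕ) (q σ q' σ' y : ℝ) (hy0 : 0 < y) (hyq : y < q) (hq1 : q ≤ 1)
    (hyq' : y < q') (hq'1 : q' < 1) (hσ0 : 0 < σ) (hσ1 : σ < 1) (hσ'0 : 0 ≤ σ') (hσ'1 : σ' ≤ 1)
    (hT₁ : q * (1 + c * σ) + q' * (1 + c' * σ') ≤ 1 + c * σ) (hT₂ : 1 + c' * σ' ≤ q * (1 + c * σ) + q' * (1 + c' * σ'))
    (hslack : y * (1 + c * σ) ≤ (q * (1 + c * σ) + q' * (1 + c' * σ') - (1 + c' * σ')) * σ)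
    (hf : y * ((1 + c * σ) + (1 + c' * σ')) ≤ σ * (q * (1 + c * σ) + q' * (1 + c' * σ')))
    (hf' : y * ((1 + c * σ) + (1 + c' * σ')) ≤ σ' * (q * (1 + c * σ) + q' * (1 + c' * σ'))) :
    InGatedCatHull y (q * (1 + c * σ) + q' * (1 + c' * σ')) (c + 1 + (c' + 1))
      (lconv (c + 1) (c' + 1) (lpSib c q σ) (lpSib c' q' σ')) := by
  have hP : CatBuilt σ (c + 1) (slice (pointLaw 1) c σ) := cat_lpRho c σ σ hσ0 hσ1 le_rfl hσ1.le
  have hm' : 0 < 1 + (c' : ℝ) * σ' := by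
    have : (0 : ℝ) ≤ c' * σ' := mul_nonneg (Nat.cast_nonneg _) hσ'0
    linarith
  have hT0 : 0 < q * (1 + c * σ) + q' * (1 + c' * σ') := lt_of_lt_of_le hm' hT₂
  have h1 : y * ((1 + c * σ) + (1 + c' * σ')) ≤ 1 * (q * (1 + c * σ) + q' * (1 + c' * σ')) := by
    rw [one_mul]
    exact hf'.trans (mul_le_of_le_one_left hT0.le hσ'1)
  have key := catPairBlob_inGatedCatHull_of_nested [(c', σ'), (1, 1)] hy0 hyq hq1 hyq' hq'1 hσ1 hP
    (by rw [lpRho_blobMean]; exact hm')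
    (by rw [lpRho_mean, lpRho_blobMean]; exact hT₁) (by rw [lpRho_mean, lpRho_blobMean]; exact hT₂)
    (by rw [lpRho_mean, lpRho_blobMean]; exact hslack) (by rw [lpRho_mean, lpRho_blobMean]; exact hf)
    (fun p hp => by
      simp only [List.mem_cons, List.not_mem_nil, or_false] at hp
      rcases hp with rfl | rfl
      · rw [lpRho_mean, lpRho_blobMean]; exact ⟨hf', hσ'1⟩
      · rw [lpRho_mean, lpRho_blobMean]; exact ⟨h1, le_rfl⟩)
  rw [lpRho_mean, lpRho_blobMean, lpRho_blobTop, ← lpRho_eq_blobLaw] at key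
  exact key

end LawDec
end Quant
end Summit.CriticalPhenomena.PercolationContinuityZ3.Theorems
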